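import Summits.BirchSwinnertonDyer.BirchSwinnertonDyer.Theorems.CMKolyvaginAtInertTwoPairDataAtTwo
import Summits.BirchSwinnertonDyer.BirchSwinnertonDyer.Theorems.CMKolyvaginAtInertTwoLiftGroupsAllAtTwo
import HarnessLib

/-!
# Route `CMKolyvaginAtInertTwo`, crux `CMKolyvaginExactAtInertTwo` (stmt-BirchSwinnertonDyer-24277):
# THE LIFT GROUPS WITH (IND) PLACED IN THE PAIR CURRENCY `V = H¹(K,E[2^M])^{ε} × H¹(K,E[2^M])^{−ε}`

Seat `bsd-line-cmk2-p1` g14 (cell `bsd-print-cf2`); helper (`--supports stmt-BirchSwinnertonDyer-24277`).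
THEOREMS ONLY: no definition, no named fact, no `sorry`; no item is closed; BSD is not proved by this.

The bridge from the abstract lift groups `exists_liftGroups` (`…LiftGroupsAllAtTwo`, T5′) to the
LITERAL hypotheses `hZp hZm hind hIND` of the adaptive telescope
`card_mul_card_le_two_pow_of_pair` (`…AdaptiveTelescopeAtTwo`): the abstract groups `Zp ≤ S₁`,
`Zm ≤ S₂` are transported along injections `j₁ : S₁ → V^{ε}`, `j₂ : S₂ → V^{−ε}` (in the telescope:
restriction `Sel_{2^M}(E/ℚ) → H¹(K,E[2^M])^{ε}`, `Sel_{2^M}(E^{D}/ℚ) → H¹(K,E[2^M])^{−ε}`) and placed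
as `j₁(Zp) × 0`, `0 × j₂(Zm)` in `V`. Then: they lie in the eigengroups `pairEig ε (±ε)`; they keep
their orders; `ℤ(j₁ x, 0) ⊓ (j₁(Zp) × 0 ⊔ 0 × j₂(Zm)) = ⊥` (the telescope's `hind`); and the abstract
(IND) `r₁ u = r₂ v ⟹ u = v = 0` becomes the telescope's `(j₁(Zp) × 0 ⊔ Δ) ⊓ (0 × j₂(Zm)) = ⊥` with
`Δ = pairDelta` (KERNEL-STATUS §13.2 dictionary; MEMO-T5prime-threading §1).

* `prod_bot_sup_bot_prod`, `natCard_prod_bot`, `natCard_bot_prod`, `finite_prod` — product plumbing;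
* `mem_pairEig_self_of_mem_prod_bot`, `mem_pairEig_neg_of_mem_bot_prod` — eigengroup membership;
* `zmultiples_inf_sup_eq_bot` — `hind` from `Disjoint ℤx₁ Zp₀`;
* `sup_pairDelta_inf_eq_bot` — `hIND` from "no collision `(u : H¹) = (v : H¹)` with `v ≠ 0`";
* `exists_liftGroups_pairV` — everything at once from `exists_liftGroups`.

References: [McCallumLMS1991] §5 Thm. 5.4 (p. 307); [Kolyvagin1989Izv] §3.
-/

-- single-conjunct summit: `Summit.BirchSwinnertonDyer.BirchSwinnertonDyer.…` repeats the name by design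
set_option linter.dupNamespace false
set_option autoImplicit false

noncomputable section

open scoped Classical
open WeierstrassCurve NumberField
open Literature.NumberTheory.GaloisRepresentations
open Literature.NumberTheory.EllipticCurves Literature.NumberTheory.EllipticCurves.KolyvaginDescent

namespace Summit.BirchSwinnertonDyer.BirchSwinnertonDyer.Theorems.KolyvaginPairDataTwo

universe u v

section Plumbing

variable {X : Type*} [AddCommGroup X] {Y : Type*} [AddCommGroup Y]

/-- `H × 0 ⊔ 0 × K = H × K` for additive subgroups. [folklore] -/
theorem prod_bot_sup_bot_prod (H : AddSubgroup X) (K : AddSubgroup Y) :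
    H.prod (⊥ : AddSubgroup Y) ⊔ (⊥ : AddSubgroup X).prod K = H.prod K := by
  refine le_antisymm (sup_le (AddSubgroup.prod_mono le_rfl bot_le) (AddSubgroup.prod_mono bot_le le_rfl)) ?_
  intro w hw
  rw [AddSubgroup.mem_prod] at hw
  have h1 : ((w.1, 0) : X × Y) ∈ H.prod (⊥ : AddSubgroup Y) :=
    AddSubgroup.mem_prod.mpr ⟨hw.1, AddSubgroup.mem_bot.mpr rfl⟩
  have h2 : ((0, w.2) : X × Y) ∈ (⊥ : AddSubgroup X).prod K :=
    AddSubgroup.mem_prod.mpr ⟨AddSubgroup.mem_bot.mpr rfl, hw.2⟩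
  have h3 : w = (w.1, 0) + (0, w.2) := by
    ext <;> simp
  rw [h3]
  exact add_mem (AddSubgroup.mem_sup_left h1) (AddSubgroup.mem_sup_right h2)

/-- `#(H × 0) = #H`. [folklore] -/
theorem natCard_prod_bot (H : AddSubgroup X) :
    Nat.card ↥(H.prod (⊥ : AddSubgroup Y)) = Nat.card H := by
  rw [Nat.card_congr (AddSubgroup.prodEquiv H (⊥ : AddSubgroup Y)).toEquiv, Nat.card_prod,
    AddSubgroup.card_bot, mul_one]

/-- `#(0 × K) = #K`. [folklore] -/
theorem natCard_bot_prod (K : AddSubgroup Y) :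
    Nat.card ↥((⊥ : AddSubgroup X).prod K) = Nat.card K := by
  rw [Nat.card_congr (AddSubgroup.prodEquiv (⊥ : AddSubgroup X) K).toEquiv, Nat.card_prod,
    AddSubgroup.card_bot, one_mul]

/-- `H × K` is finite for finite `H`, `K` (use with `haveI`). [folklore] -/
theorem finite_prod (H : AddSubgroup X) (K : AddSubgroup Y) [Finite H] [Finite K] :
    Finite ↥(H.prod K) :=
  Finite.of_equiv _ (AddSubgroup.prodEquiv H K).toEquiv.symm

end Plumbing

variable (W : WeierstrassCurve ℚ) {K : Type} [Field K] [NumberField K] (c : K ≃ₐ[ℚ] K) (M : ℕ)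

/-- `Zp₀ × 0 ≤ V^{ε} × 0 = pairEig ε ε`. [cite: Kolyvagin1989Izv, §3] -/
theorem mem_pairEig_self_of_mem_prod_bot (ε : ℤ) {Zp₀ : AddSubgroup ↥(eigK W c M ε)}
    {v : PairV W c M ε} (hv : v ∈ Zp₀.prod (⊥ : AddSubgroup ↥(eigK W c M (-ε)))) :
    v ∈ pairEig W c M ε ε := by
  rw [pairEig_self, AddSubgroup.mem_prod]
  exact ⟨AddSubgroup.mem_top _, (AddSubgroup.mem_prod.mp hv).2⟩

/-- `0 × Zm₀ ≤ 0 × V^{−ε} = pairEig ε (−ε)` for a sign `ε`. [cite: Kolyvagin1989Izv, §3] -/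
theorem mem_pairEig_neg_of_mem_bot_prod {ε : ℤ} (hε : ε = 1 ∨ ε = -1)
    {Zm₀ : AddSubgroup ↥(eigK W c M (-ε))} {v : PairV W c M ε}
    (hv : v ∈ (⊥ : AddSubgroup ↥(eigK W c M ε)).prod Zm₀) :
    v ∈ pairEig W c M ε (-ε) := by
  rw [pairEig_neg W c M hε, AddSubgroup.mem_prod]
  exact ⟨(AddSubgroup.mem_prod.mp hv).1, AddSubgroup.mem_top _⟩

/-- **The telescope's `hind`.** If `ℤx₁ ∩ Zp₀ = 0` in `V^{ε}` then
`ℤ(x₁, 0) ⊓ (Zp₀ × 0 ⊔ 0 × Zm₀) = ⊥` in `V`. [cite: McCallumLMS1991, §5 Thm. 5.4 (p. 307)] -/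
theorem zmultiples_inf_sup_eq_bot (ε : ℤ) (x₁ : ↥(eigK W c M ε)) (Zp₀ : AddSubgroup ↥(eigK W c M ε))
    (Zm₀ : AddSubgroup ↥(eigK W c M (-ε))) (hx : Disjoint (AddSubgroup.zmultiples x₁) Zp₀) :
    AddSubgroup.zmultiples ((x₁, 0) : PairV W c M ε) ⊓
      (Zp₀.prod (⊥ : AddSubgroup ↥(eigK W c M (-ε))) ⊔ (⊥ : AddSubgroup ↥(eigK W c M ε)).prod Zm₀) = ⊥ := by
  rw [prod_bot_sup_bot_prod, AddSubgroup.eq_bot_iff_forall]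
  intro w hw
  rw [AddSubgroup.mem_inf, AddSubgroup.mem_zmultiples_iff, AddSubgroup.mem_prod] at hw
  obtain ⟨⟨n, hn⟩, hw1, -⟩ := hw
  have h1 : w.1 = n • x₁ := by rw [← hn]; rfl
  have h2 : w.2 = 0 := by
    rw [← hn, Prod.smul_snd, zsmul_zero]
  have h3 : w.1 ∈ AddSubgroup.zmultiples x₁ := by
    rw [h1]
    exact AddSubgroup.zsmul_mem _ (AddSubgroup.mem_zmultiples x₁) n
  have h4 : w.1 = 0 := by
    have h := hx.le_bot (AddSubgroup.mem_inf.mpr ⟨h3, hw1⟩)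
    rwa [AddSubgroup.mem_bot] at h
  exact Prod.ext h4 h2

/-- **The telescope's (IND) `hIND`.** If no non-zero `v ∈ Zm₀ ≤ V^{−ε}` collides in `H¹(K, E[2^M])`
with an element of `Zp₀ ≤ V^{ε}`, then `(Zp₀ × 0 ⊔ Δ) ⊓ (0 × Zm₀) = ⊥`, `Δ = pairDelta` the kernel of
`(u, v) ↦ u + v`. [cite: McCallumLMS1991, §5 Thm. 5.4 (p. 307)] -/
theorem sup_pairDelta_inf_eq_bot (ε : ℤ) (Zp₀ : AddSubgroup ↥(eigK W c M ε))
    (Zm₀ : AddSubgroup ↥(eigK W c M (-ε)))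
    (hcoll : ∀ u ∈ Zp₀, ∀ v ∈ Zm₀,
      (u : galH1Torsion (W.baseChange K) ((2 ^ M : ℕ) : ℤ)) = (v : galH1Torsion (W.baseChange K)
        ((2 ^ M : ℕ) : ℤ)) → v = 0) :
    (Zp₀.prod (⊥ : AddSubgroup ↥(eigK W c M (-ε))) ⊔ pairDelta W c M ε) ⊓
      (⊥ : AddSubgroup ↥(eigK W c M ε)).prod Zm₀ = ⊥ := by
  rw [AddSubgroup.eq_bot_iff_forall]
  intro w hw
  rw [AddSubgroup.mem_inf, AddSubgroup.mem_prod] at hw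
  obtain ⟨hw1, hw2, hw3⟩ := hw
  rw [AddSubgroup.mem_bot] at hw2
  obtain ⟨y, hy, z, hz, hyz⟩ := AddSubgroup.mem_sup.mp hw1
  rw [AddSubgroup.mem_prod, AddSubgroup.mem_bot] at hy
  rw [mem_pairDelta_iff] at hz
  -- `z = w - y = (-y.1, w.2)`, so `-(y.1 : H¹) + (w.2 : H¹) = 0`
  have hz1 : z.1 = -y.1 := by
    have h : y.1 + z.1 = w.1 := by rw [← hyz]; rfl
    rw [hw2] at h
    exact eq_neg_of_add_eq_zero_right h
  have hz2 : z.2 = w.2 := by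
    have h : y.2 + z.2 = w.2 := by rw [← hyz]; rfl
    rwa [hy.2, zero_add] at h
  rw [hz1, hz2, AddSubgroup.coe_neg, neg_add_eq_zero] at hz
  have h4 : w.2 = 0 := hcoll y.1 hy.1 w.2 hw3 hz
  exact Prod.ext hw2 h4

/-- **The lift groups with (IND) in the pair currency.** In the situation of `exists_liftGroups`
(`π : S₁ ↠ A` with kernel `⟨x⟩`, `x` of maximal order; alternating nondegenerate `ℚ/ℤ`-pairings on
`A`, `S₂` killed by `p^k`) with injections `j₁ : S₁ → V^{ε}`, `j₂ : S₂ → V^{−ε}`: there are `Zp ≤ S₁`,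
`Zm ≤ S₂`, `ℤx ∩ Zp = 0`, `π(Zp)` and `Zm` isotropic with `(#Zp)² = #A`, `(#Zm)² = #S₂`, whose
placements `j₁(Zp) × 0`, `0 × j₂(Zm)` in `V` have orders `#Zp`, `#Zm`, lie in `pairEig ε ε`,
`pairEig ε (−ε)`, and satisfy the telescope's `hind` (`ℤ(j₁ x, 0) ⊓ (j₁(Zp) × 0 ⊔ 0 × j₂(Zm)) = ⊥`)
and (IND) `hIND` (`(j₁(Zp) × 0 ⊔ Δ) ⊓ (0 × j₂(Zm)) = ⊥`).
[cite: McCallumLMS1991, §5 Thm. 5.4 (proof, p. 307: the maximal isotropic subgroup D)] -/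
theorem exists_liftGroups_pairV (ε : ℤ) {S₁ : Type u} [AddCommGroup S₁] [Finite S₁]
    {S₂ : Type u} [AddCommGroup S₂] [Finite S₂] {A : Type v} [AddCommGroup A]
    {p : ℕ} (hp : p.Prime)
    (π : S₁ →+ A) (hπ : Function.Surjective π) (x : S₁)
    (hker : π.ker = AddSubgroup.zmultiples x) (hx : addOrderOf x = AddMonoid.exponent S₁)
    (BA : A →+ A →+ AddCircle (1 : ℚ)) (hAalt : ∀ a, BA a a = 0)
    (hAnd : ∀ a, (∀ b, BA a b = 0) → a = 0)
    (BB : S₂ →+ S₂ →+ AddCircle (1 : ℚ)) (hBalt : ∀ v, BB v v = 0)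
    (hBnd : ∀ v, (∀ w, BB v w = 0) → v = 0) {k : ℕ} (hpA : ∀ a : A, p ^ k • a = 0)
    (hpB : ∀ v : S₂, p ^ k • v = 0)
    (j₁ : S₁ →+ ↥(eigK W c M ε)) (j₂ : S₂ →+ ↥(eigK W c M (-ε)))
    (hj₁ : Function.Injective j₁) (hj₂ : Function.Injective j₂) :
    ∃ (Zp : AddSubgroup S₁) (Zm : AddSubgroup S₂),
      Disjoint (AddSubgroup.zmultiples x) Zp ∧
      (∀ a ∈ Zp, ∀ b ∈ Zp, BA (π a) (π b) = 0) ∧ Nat.card Zp ^ 2 = Nat.card A ∧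
      (∀ v ∈ Zm, ∀ w ∈ Zm, BB v w = 0) ∧ Nat.card Zm ^ 2 = Nat.card S₂ ∧
      Nat.card ↥((Zp.map j₁).prod (⊥ : AddSubgroup ↥(eigK W c M (-ε)))) = Nat.card Zp ∧
      Nat.card ↥((⊥ : AddSubgroup ↥(eigK W c M ε)).prod (Zm.map j₂)) = Nat.card Zm ∧
      (∀ v ∈ (Zp.map j₁).prod (⊥ : AddSubgroup ↥(eigK W c M (-ε))), v ∈ pairEig W c M ε ε) ∧
      (ε = 1 ∨ ε = -1 →
        ∀ v ∈ (⊥ : AddSubgroup ↥(eigK W c M ε)).prod (Zm.map j₂), v ∈ pairEig W c M ε (-ε)) ∧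
      AddSubgroup.zmultiples ((j₁ x, 0) : PairV W c M ε) ⊓
          ((Zp.map j₁).prod (⊥ : AddSubgroup ↥(eigK W c M (-ε))) ⊔
            (⊥ : AddSubgroup ↥(eigK W c M ε)).prod (Zm.map j₂)) = ⊥ ∧
      ((Zp.map j₁).prod (⊥ : AddSubgroup ↥(eigK W c M (-ε))) ⊔ pairDelta W c M ε) ⊓
          (⊥ : AddSubgroup ↥(eigK W c M ε)).prod (Zm.map j₂) = ⊥ := by
  obtain ⟨Zp, Zm, hdisj, hisoA, hcardA, hisoB, hcardB, hIND⟩ :=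
    KolyvaginLiftGroupsTwo.exists_liftGroups hp π hπ x hker hx BA hAalt hAnd BB hBalt hBnd hpA hpB
      ((eigK W c M ε).subtype.comp j₁) ((eigK W c M (-ε)).subtype.comp j₂)
      ((eigK W c M ε).subtype_injective.comp hj₁) ((eigK W c M (-ε)).subtype_injective.comp hj₂)
  refine ⟨Zp, Zm, hdisj, hisoA, hcardA, hisoB, hcardB, ?_, ?_, ?_, ?_, ?_, ?_⟩
  · rw [natCard_prod_bot, AddSubgroup.card_map_of_injective hj₁]
  · rw [natCard_bot_prod, AddSubgroup.card_map_of_injective hj₂]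
  · intro v hv
    exact mem_pairEig_self_of_mem_prod_bot W c M ε hv
  · intro hε v hv
    exact mem_pairEig_neg_of_mem_bot_prod W c M hε hv
  · refine zmultiples_inf_sup_eq_bot W c M ε (j₁ x) (Zp.map j₁) (Zm.map j₂) ?_
    rw [disjoint_iff, AddSubgroup.eq_bot_iff_forall]
    intro w hw
    rw [AddSubgroup.mem_inf, AddSubgroup.mem_zmultiples_iff, AddSubgroup.mem_map] at hw
    obtain ⟨⟨n, hn⟩, z, hz, hzw⟩ := hw
    have h1 : j₁ z = j₁ (n • x) := by rw [hzw, ← hn, map_zsmul]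
    have h2 : z = n • x := hj₁ h1
    have h3 : z ∈ AddSubgroup.zmultiples x := by
      rw [h2]
      exact AddSubgroup.zsmul_mem _ (AddSubgroup.mem_zmultiples x) n
    have h4 : z = 0 := by
      have h := hdisj.le_bot (AddSubgroup.mem_inf.mpr ⟨h3, hz⟩)
      rwa [AddSubgroup.mem_bot] at h
    rw [← hzw, h4, map_zero]
  · refine sup_pairDelta_inf_eq_bot W c M ε (Zp.map j₁) (Zm.map j₂) ?_
    intro u hu v hv huv
    rw [AddSubgroup.mem_map] at hu hv
    obtain ⟨a, ha, hau⟩ := hu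
    obtain ⟨b, hb, hbv⟩ := hv
    have h1 : ((eigK W c M ε).subtype.comp j₁) a = ((eigK W c M (-ε)).subtype.comp j₂) b := by
      rw [AddMonoidHom.comp_apply, AddMonoidHom.comp_apply, hau, hbv]
      exact huv
    have h2 := hIND a ha b hb h1
    rw [← hbv, h2.2, map_zero]

end Summit.BirchSwinnertonDyer.BirchSwinnertonDyer.Theorems.KolyvaginPairDataTwo

end
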